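import Literature.AnabelianGeometry.AbsoluteAnabelian.AbsTopII.BelyiCuspidalizationDatumSchemaScope
import HarnessLib

/-!
# [AbsTopII] Cor 3.7″ / Cor 3.8 inside a datum, WITH the (3_Π)-kernel law: a law-ABIDING separation
# model — the law decides the datum facts only at cusp-free data

S. Mochizuki, *Topics in Absolute Anabelian Geometry II* [AbsTopII] (bib `MochizukiAbsTopII2013`;
manuscript pagination, lit key `paper:url-585b8d0ad0d9`): Cor 3.7 pp. 72–73, Cor 3.8 p. 74; [AbsTopI]
(`MochizukiAbsTopI2012`) Def 4.2 (iii) (c) p. 50: "Type •: [...] a surjection of profinite groups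
`φ : Πⱼ ↠ Πⱼ₊₁`, such that `Ker(φ)` is topologically normally generated by a cuspidal decomposition group
`C` in `Δⱼ`".

PROOF-ONLY sequel (no definition / instance / structure) of `BelyiCuspidalizationDatumSchemaScope.lean`
(p441764 / p442459, abc-iut-f-064, row «COR37-DATUM-CERT»; abc-iut-L4-lead RULING #8h (3) asks
abc-iut-L4-t6 whether to TYPE the kernel law located there).  That file showed: WITHOUT the law the
cusp-free separation model refutes the ∀-closures of `toBelyiModel.Cor_3_7''` / `toBelyiModel.Cor_3_8`,
and WITH the law (hypothesis-shaped: `Ker ψ ≤` the closed normal subgroup generated by the decomposition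
groups of the cusps OF `U`) both facts HOLD at cusp-free data.  THIS file settles what typing the law
would and would not buy:

* `BelyiDatumModel.exists_kerLaw_separation_model` — a junk DATUM model over the REAL field `ℚ_2`
  (universe `0`) in which THE KERNEL LAW HOLDS FOR EVERY DATUM MORPHISM (it is built into the datum's
  Hom-sets: every representative `ψ` of every `[π₁(f)]`, `f : A → B`, has `Ker ψ` inside the closed
  normal closure of the decomposition groups of the cusps recorded on `A`), the `EllipticDatumModel`
  flags are again EQUAL to their laws, the members `X₁ ≅ X₂` (`Π = G × G ↠ G`, `IsCor37Member`
  unconditionally) record NO cusp, and the non-member `U` records ONE cusp whose decomposition group is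
  `Ker(pr₁) = 1 × 1 × G ⊆ Π_U = (G × G) × G` — so the datum open immersion `ι : U → X₁`,
  `[π₁(ι)] = [pr₁]`, OBEYS the law and still identifies points; and there `¬ M.toBelyiModel.Cor_3_7''`
  (kernel form at the cusp-free member `X₁`) and `¬ M.toBelyiModel.Cor_3_8`;
* `not_forall_toBelyiModel_cor_3_7''_of_kerLaw`, `not_forall_toBelyiModel_cor_3_8_of_kerLaw` — even over
  datum models satisfying the kernel law model-wide, the ∀-closures are REFUTED: typing the law as an
  `EllipticDatumModel` field would NOT make the datum facts closed; they stay HYPOTHESES on `(𝒟, M)`,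
  bindable per instance (R5).  Together with p442459 (`toBelyiModel_cor_3_7''_of_ker_le_of_isEmpty_cusp`,
  `toBelyiModel_cor_3_8_of_ker_le_of_isEmpty_cusp`): the law DECIDES the facts exactly at cusp-free data,
  and the content of Cor 3.7 (a) — "the chain of •'s computes `Π_U ↠ Π_V`" — lives precisely where cusps
  ARE recorded.

READING (honest framing): statements about OUR typed interfaces; junk no étale `π₁` supplies: a curve
of strictly Belyi type is AFFINE (Def 3.5: isogenous to a hyperbolic curve of genus zero), so it records
cusps and the •-steps of Cor 3.7 (a) exist, whereas the model records no cusp on `X₁`, no chain term, and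
`Π = G × G`; refuted-as-schema ≠ refuted-in-print; no side taken on [IUTchIII] Cor 3.12; typed ≠ proved.
-/

open CategoryTheory Topology
open scoped Pointwise

universe u

namespace Literature.AnabelianGeometry.AbsoluteAnabelian.AbsTopII

open Literature.AlgebraicGeometry.Frobenioids (IsSlimGroup)
open FundamentalExtension
open AbsTopI (ConstructionDataClass)
open AbsTopIII (IsGeneralizedSubpadicFor IsSubpadicFor cyclotomicChar)
open AugmentedProfiniteGrp

/-! ## Kernels of representatives of one outer homomorphism -/

section Representatives

variable {G : ProfiniteGrp.{u}} {A B : AugmentedProfiniteGrp G}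

/-- `Δ`-conjugate homomorphisms over `G` have the same kernel: the kernel is a datum of the OUTER
homomorphism. [cite: MochizukiAbsTopI2012, Def 4.6 (ii) p.56] -/
theorem HomOver.ker_eq_of_mk_eq_mk {φ ψ : HomOver A B} (h : OuterHom.mk ψ = OuterHom.mk φ) :
    ψ.toHom.toMonoidHom.ker = φ.toHom.toMonoidHom.ker := by
  obtain ⟨g, hg, rfl⟩ := OuterHom.mk_eq_mk.mp h.symm
  ext x
  simp only [MonoidHom.mem_ker, ContinuousMonoidHom.coe_toMonoidHom]
  exact (MulAut.conj g).map_eq_one_iff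

/-- A representative of an outer ISOMORPHISM has trivial kernel, hence satisfies any kernel bound.
[cite: MochizukiAbsTopI2012, Def 4.6 (ii) p.56] -/
theorem HomOver.ker_le_of_isIso_mk {ψ : HomOver A B} (h : (OuterHom.mk ψ).IsIso)
    (S : Subgroup A.arith) : ψ.toHom.toMonoidHom.ker ≤ S := by
  have hinj : Function.Injective ψ.toHom.toMonoidHom := fun a b hab =>
    ((OuterHom.isIso_mk ψ).mp h).1 hab
  rw [(MonoidHom.ker_eq_bot_iff _).mpr hinj]
  exact bot_le

end Representatives

/-- A subgroup contained in ONE recorded decomposition group satisfies the kernel bound of the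
(3_Π)-law (it lies in the closed normal closure of all of them). [cite: MochizukiAbsTopI2012, Def 4.2 (iii) p.50] -/
theorem _root_.Literature.AnabelianGeometry.AbsoluteAnabelian.FundamentalExtension.CuspidalData.le_topologicalClosure_normalClosure_of_le
    {E : FundamentalExtension.{u}}
    (C : CuspidalData E) (c : C.Cusp) {H : Subgroup E.arith} (h : H ≤ C.Dcusp c) :
    H ≤ (Subgroup.normalClosure (⋃ c : C.Cusp, (C.Dcusp c : Set E.arith))).topologicalClosure :=
  fun _ hx => Subgroup.le_topologicalClosure _
    (Subgroup.subset_normalClosure (Set.mem_iUnion.mpr ⟨c, h hx⟩))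

/-! ## The law-abiding separation model -/

/-- **The SEPARATION MODEL WITH THE KERNEL LAW** (universe `0`): a class `𝒟` over `ℚ_2` (chain-full,
rel-isom-DGC) and a `BelyiDatumModel` over it such that
* THE KERNEL LAW HOLDS for every datum NF-open `(U, ι, ψ)` of every object: `Ker ψ` lies in the closed
  normal subgroup generated by the decomposition groups of the cusps recorded on `U`;
* the flags ARE their laws (`IsOpenImmersion f` iff every representative of `[π₁(f)]` is surjective);
* every member satisfies `IsCor37Member` and records NO cusp;
* yet `¬ M.toBelyiModel.Cor_3_7''` and `¬ M.toBelyiModel.Cor_3_8`: the open `U → X₁` records ONE cusp with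
  decomposition group `Ker(pr₁)`, so `pr₁ : (G × G) × G ↠ G × G` obeys the law and identifies points,
  while `X₁` (cusp-free) offers no •-step and every open of `X₂ ≅ X₁` is bijective.
[cite: MochizukiAbsTopII2013, Cor 3.7 pp.72-73] -/
theorem BelyiDatumModel.exists_kerLaw_separation_model :
    ∃ (𝒟 : ConstructionDataClass.{0}) (M : BelyiDatumModel 𝒟),
      𝒟.IsChainFull ∧ 𝒟.RelIsomDGC ∧
      (∀ (b : 𝒟.Base) (X : (𝒟.datum b).Obj) (O : M.NFOpen b X),
        (O.ψ.toHom.toMonoidHom.ker : Subgroup ((𝒟.datum b).ext O.U).arith) ≤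
          (Subgroup.normalClosure (⋃ c : (M.cusps b O.U).Cusp,
            ((M.cusps b O.U).Dcusp c : Set ((𝒟.datum b).ext O.U).arith))).topologicalClosure) ∧
      (∀ {b : 𝒟.Base} {A B : (𝒟.datum b).Obj} (f : (𝒟.datum b).Hom A B),
        M.IsOpenImmersion f ↔ ∀ ψ : HomOver ((𝒟.datum b).grp A) ((𝒟.datum b).grp B),
          OuterHom.mk ψ = (𝒟.datum b).outerHom f → Function.Surjective ψ.toHom) ∧
      (∀ (b : 𝒟.Base) (X : (𝒟.datum b).Obj), 𝒟.Mem b X → M.toBelyiModel.IsCor37Member b X) ∧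
      (∀ (b : 𝒟.Base) (X : (𝒟.datum b).Obj), 𝒟.Mem b X → IsEmpty (M.cusps b X).Cusp) ∧
      ¬ M.toBelyiModel.Cor_3_7'' ∧ ¬ M.toBelyiModel.Cor_3_8 := by
  let Γ : ProfiniteGrp.{0} := absoluteGaloisGrp ℚ_[2]
  -- the members: `Π := G × G ↠ G` (second projection)
  let P : AugmentedProfiniteGrp Γ :=
    { arith := ProfiniteGrp.of (Γ × Γ), aug := ContinuousMonoidHom.snd Γ Γ
      aug_surjective := fun g => ⟨(1, g), rfl⟩ }
  -- the open `U`: `Π_U := (G × G) × G ↠ G`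
  let Q : AugmentedProfiniteGrp Γ :=
    { arith := ProfiniteGrp.of ((Γ × Γ) × Γ)
      aug := (ContinuousMonoidHom.snd Γ Γ).comp (ContinuousMonoidHom.fst (Γ × Γ) Γ)
      aug_surjective := fun g => ⟨((1, g), 1), rfl⟩ }
  -- `[π₁(U ↪ X₁)] = [pr₁]`
  let ι₀ : HomOver Q P := ⟨ContinuousMonoidHom.fst (Γ × Γ) Γ, fun _ => rfl⟩
  -- the ONE cusp recorded on `U`: decomposition group `Ker(pr₁) = 1 × 1 × G`
  let K₀ : Subgroup ((Γ × Γ) × Γ) := (MonoidHom.fst (Γ × Γ) Γ).ker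
  have hK₀ : IsClosed (K₀ : Set ((Γ × Γ) × Γ)) := by
    rw [MonoidHom.coe_ker]
    exact isClosed_singleton.preimage continuous_fst
  have hι₀K : ι₀.toHom.toMonoidHom.ker = K₀ := rfl
  let grp : Option Bool → AugmentedProfiniteGrp Γ := fun o => o.elim Q fun _ => P
  -- cusps: none on the members, one on `U`
  let C : ∀ o : Option Bool, CuspidalData (grp o).toExtension := fun o =>
    o.rec
      { Cusp := PUnit.{1}
        Dcusp := fun _ => K₀
        Icusp := fun _ => K₀ ⊓ Q.toExtension.geom
        Icusp_eq := fun _ => rfl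
        isClosed_Dcusp := fun _ => hK₀
        eq_of_conj := fun _ _ _ _ => rfl }
      fun _ =>
        { Cusp := PEmpty.{1}
          Dcusp := fun x => x.elim
          Icusp := fun x => x.elim
          Icusp_eq := fun x => x.elim
          isClosed_Dcusp := fun x => x.elim
          eq_of_conj := fun x => x.elim }
  -- the kernel law, as a predicate on outer homomorphisms out of `A`
  let Law : ∀ A B : Option Bool, OuterHom (grp A) (grp B) → Prop := fun A B q =>
    ∀ ψ : HomOver (grp A) (grp B), OuterHom.mk ψ = q →
      (ψ.toHom.toMonoidHom.ker : Subgroup (grp A).toExtension.arith) ≤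
        (Subgroup.normalClosure (⋃ c : (C A).Cusp,
          ((C A).Dcusp c : Set (grp A).toExtension.arith))).topologicalClosure
  have hLaw_iso : ∀ (A B : Option Bool) (q : OuterHom (grp A) (grp B)), q.IsIso → Law A B q := by
    intro A B q hq ψ hψ
    rw [← hψ] at hq
    exact HomOver.ker_le_of_isIso_mk hq _
  let D : RelativeAnabelianDatum Γ :=
    { Obj := Option Bool
      Hom := fun A B =>
        {q : OuterHom (grp A) (grp B) // ((A ≠ none ∨ B = some false) → q.IsIso) ∧ Law A B q}
      IsIso := fun f => f.1.IsIso
      IsHyperbolicCurve := fun _ => True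
      primes := Set.univ
      grp := grp
      outerHom := fun f => f.1 }
  let 𝒟 : ConstructionDataClass.{0} :=
    { Base := PUnit.{1}
      fld := fun _ => ℚ_[2]
      instField := fun _ => inferInstance
      instCharZero := fun _ => inferInstance
      datum := fun _ => D
      Mem := fun _ X => X ≠ none
      IsHyperbolicOrbicurve := fun _ _ => True
      isHyperbolicOrbicurve_of_isHyperbolicCurve := fun _ _ _ => trivial
      chainTerms := fun _ _ => ∅ }
  let M : BelyiDatumModel 𝒟 :=
    { cusps := fun _ o => C o
      IsFinEt := fun f => ∀ φ, OuterHom.mk φ = f.1 → Function.Injective φ.toHom ∧ φ.IsOpenHom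
      isFinEt_injective := fun _ h φ hφ => h φ hφ
      IsOpenImmersion := fun f => ∀ ψ, OuterHom.mk ψ = f.1 → Function.Surjective ψ.toHom
      isOpenImmersion_surjective := fun _ h ψ hψ => h ψ hψ
      IsOncePuncturedElliptic := fun _ _ => True
      IsEllipticallyAdmissible := fun _ _ => True
      IsStrictlyBelyiType := fun _ _ => True
      IsDefinedOverNF := fun _ _ => True }
  have hfull : 𝒟.IsChainFull := fun _ _ _ _ ht => ((Set.mem_empty_iff_false _).mp ht).elim
  have hGC : 𝒟.RelIsomDGC := fun _ A B _ _ =>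
    ⟨fun f hf => hf, fun f _ f' _ h => Subtype.ext h,
      fun c hc => ⟨⟨c, fun _ => hc, hLaw_iso A B c hc⟩, hc, rfl⟩⟩
  have hk : IsGeneralizedSubpadicFor ℚ_[2] 2 := (IsSubpadicFor.padic 2).isGeneralizedSubpadicFor
  have hΓ : IsSlimGroup Γ :=
    isSlimGroup_of_iso_absoluteGaloisGrp_of_isGeneralizedSubpadicFor_holds hk (Iso.refl _)
  -- `Δ = G × 1 ≅ G` is slim …
  let E₀ : FundamentalExtension.{0} := P.toExtension
  let e : Γ ≃ₜ* ↥E₀.geom :=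
    { toFun := fun g => ⟨(g, 1), rfl⟩
      invFun := fun x => x.1.1
      left_inv := fun _ => rfl
      right_inv := fun x => by
        obtain ⟨⟨g, h⟩, hx⟩ := x
        have hh : h = 1 := hx
        subst hh
        rfl
      map_mul' := fun g h => Subtype.ext (Prod.ext rfl (one_mul (1 : Γ)).symm)
      continuous_toFun := Continuous.subtype_mk (continuous_id.prodMk continuous_const) _
      continuous_invFun := continuous_fst.comp continuous_subtype_val }
  have hΔ : IsSlimGroup ↥E₀.geom := isSlimGroup_of_continuousMulEquiv e hΓ
  -- … and nontrivial
  haveI : Infinite (Field.absoluteGaloisGroup ℚ_[2]) := Padic.infinite_absoluteGaloisGroup 2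
  obtain ⟨σ, hσ⟩ := exists_ne (1 : Field.absoluteGaloisGroup ℚ_[2])
  have hne : E₀.geom ≠ ⊥ := by
    intro h
    have hmem : ((σ, 1) : Γ × Γ) ∈ E₀.geom := rfl
    rw [h] at hmem
    exact hσ (Prod.mk_eq_one.mp (Subgroup.mem_bot.mp hmem)).1
  have hX : ∀ x : Bool, M.toBelyiModel.IsCor37Member PUnit.unit (some x) := fun x =>
    M.toBelyiModel.isCor37Member_of_isGeneralizedSubpadicFor (Option.some_ne_none x) rfl trivial
      hk hΔ hne
  -- the datum open immersion `ι : U → X₁` OBEYS the kernel law: `Ker(g · pr₁ · g⁻¹) = Ker(pr₁) = D_cusp`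
  have hιlaw : Law none (some true) (OuterHom.mk ι₀) := by
    intro ψ hψ
    rw [HomOver.ker_eq_of_mk_eq_mk hψ]
    exact (C none).le_topologicalClosure_normalClosure_of_le PUnit.unit (le_of_eq hι₀K)
  have hι : ((none : Option Bool) ≠ none ∨ some true = some false) →
      (OuterHom.mk ι₀ : OuterHom Q P).IsIso := fun h =>
    h.elim (fun h => (h rfl).elim) fun h => absurd h (by decide)
  let ι : D.Hom none (some true) := ⟨OuterHom.mk ι₀, hι, hιlaw⟩
  have hι₀ : Function.Surjective ι₀.toHom := fun g => ⟨(g, 1), rfl⟩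
  let O₁ : M.NFOpen PUnit.unit (some true) :=
    { U := none
      ι := ι
      isOpenImmersion := fun ψ hψ => HomOver.surjective_of_mk_eq_mk hψ hι₀
      definedOverNF := trivial
      ψ := ι₀
      mk_ψ := rfl }
  -- `pr₁` kills the nontrivial element `((1, 1), σ)`
  have hninj : ¬ Function.Injective O₁.ψ.toHom := by
    intro hinj
    have h1 : O₁.ψ.toHom (((1, 1), σ) : (Γ × Γ) × Γ) = O₁.ψ.toHom 1 := rfl
    exact hσ (Prod.mk_eq_one.mp (hinj h1)).2
  -- every datum morphism INTO `X₂` induces an outer isomorphism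
  have hX₂ : ∀ O₂ : M.NFOpen PUnit.unit (some false), Function.Bijective O₂.ψ.toHom := fun O₂ => by
    have h : (OuterHom.mk O₂.ψ).IsIso := by
      rw [O₂.mk_ψ]
      exact O₂.ι.2.1 (Or.inr rfl)
    exact (OuterHom.isIso_mk O₂.ψ).mp h
  refine ⟨𝒟, M, hfull, hGC, fun _ X O => O.ι.2.2 O.ψ O.mk_ψ, fun _ => Iff.rfl, ?_, ?_, ?_, ?_⟩
  · intro _ X hXmem
    obtain ⟨x, rfl⟩ := Option.ne_none_iff_exists'.mp hXmem
    exact hX x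
  · intro _ X hXmem
    obtain ⟨x, rfl⟩ := Option.ne_none_iff_exists'.mp hXmem
    exact inferInstanceAs (IsEmpty PEmpty.{1})
  · exact M.toBelyiModel.not_cor_3_7''_of_isEmpty_cusp hfull hGC (hX true)
      (inferInstanceAs (IsEmpty PEmpty.{1})) O₁ hninj
  · intro h38
    have hcyc : IsOpen (Set.range (cyclotomicChar ℚ_[2] 2)) := hk.isOpen_range_cyclotomicChar
    obtain ⟨O₂, ⟨φU, hφU⟩, -⟩ := h38 hfull hGC PUnit.unit PUnit.unit (some true) (some false)
      (hX true) (hX false) ⟨2, inferInstance, hcyc, hcyc⟩ (ContinuousMulEquiv.refl _) (by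
        ext x
        simp only [Subgroup.mem_map]
        constructor
        · rintro ⟨y, hy, rfl⟩
          exact hy
        · exact fun hx => ⟨x, hx, rfl⟩) O₁
    have key : ∀ x, O₂.ψ.toHom (φU x) = O₁.ψ.toHom x := fun x => hφU x
    refine hninj fun x y hxy => φU.injective ((hX₂ O₂).1 ?_)
    rw [key, key, hxy]

/-! ## Even with the kernel law, the ∀-closures are REFUTED -/

/-- **Typing the kernel law would NOT close the datum Cor 3.7**: over datum models in which every datum
NF-open obeys the (3_Π)-kernel law (and `𝒟` is chain-full with rel-isom-DGC, every member satisfying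
the standing hypotheses), `M.toBelyiModel.Cor_3_7''` still fails somewhere — it remains a HYPOTHESIS ON
`(𝒟, M)`, bindable per instance.  The law decides it only at cusp-free data
(`toBelyiModel_cor_3_7''_of_ker_le_of_isEmpty_cusp`, p442459). [cite: MochizukiAbsTopII2013, Cor 3.7 pp.72-73] -/
theorem BelyiDatumModel.not_forall_toBelyiModel_cor_3_7''_of_kerLaw :
    ¬ ∀ (𝒟 : ConstructionDataClass.{0}) (M : BelyiDatumModel 𝒟),
      𝒟.IsChainFull → 𝒟.RelIsomDGC →
      (∀ (b : 𝒟.Base) (X : (𝒟.datum b).Obj), 𝒟.Mem b X → M.toBelyiModel.IsCor37Member b X) →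
      (∀ (b : 𝒟.Base) (X : (𝒟.datum b).Obj) (O : M.NFOpen b X),
        (O.ψ.toHom.toMonoidHom.ker : Subgroup ((𝒟.datum b).ext O.U).arith) ≤
          (Subgroup.normalClosure (⋃ c : (M.cusps b O.U).Cusp,
            ((M.cusps b O.U).Dcusp c : Set ((𝒟.datum b).ext O.U).arith))).topologicalClosure) →
        M.toBelyiModel.Cor_3_7'' := by
  intro H
  obtain ⟨𝒟, M, hfull, hGC, hlaw, -, hmem, -, h37, -⟩ :=
    BelyiDatumModel.exists_kerLaw_separation_model
  exact h37 (H 𝒟 M hfull hGC hmem hlaw)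

/-- **… nor the datum Cor 3.8.** [cite: MochizukiAbsTopII2013, Cor 3.8 p.74] -/
theorem BelyiDatumModel.not_forall_toBelyiModel_cor_3_8_of_kerLaw :
    ¬ ∀ (𝒟 : ConstructionDataClass.{0}) (M : BelyiDatumModel 𝒟),
      𝒟.IsChainFull → 𝒟.RelIsomDGC →
      (∀ (b : 𝒟.Base) (X : (𝒟.datum b).Obj), 𝒟.Mem b X → M.toBelyiModel.IsCor37Member b X) →
      (∀ (b : 𝒟.Base) (X : (𝒟.datum b).Obj) (O : M.NFOpen b X),
        (O.ψ.toHom.toMonoidHom.ker : Subgroup ((𝒟.datum b).ext O.U).arith) ≤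
          (Subgroup.normalClosure (⋃ c : (M.cusps b O.U).Cusp,
            ((M.cusps b O.U).Dcusp c : Set ((𝒟.datum b).ext O.U).arith))).topologicalClosure) →
        M.toBelyiModel.Cor_3_8 := by
  intro H
  obtain ⟨𝒟, M, hfull, hGC, hlaw, -, hmem, -, -, h38⟩ :=
    BelyiDatumModel.exists_kerLaw_separation_model
  exact h38 (H 𝒟 M hfull hGC hmem hlaw)

end Literature.AnabelianGeometry.AbsoluteAnabelian.AbsTopII
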